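import Mathlib
import Literature.MathematicalPhysics.QuantumFieldTheory.Balaban1983to89.B11Claim309UAnalytic
import Literature.MathematicalPhysics.QuantumFieldTheory.Balaban1983to89.B11Eq185SecondDerivative
import Literature.MathematicalPhysics.QuantumFieldTheory.Balaban1983to89.B11SectG

/-!
# `Balaban1983to89.B11Eq183Differentiation` — T. Bałaban, *The variational problem and background fields in renormalization group method
# for lattice gauge theories*, Commun. Math. Phys. **102** (1985) 277–309 [Balaban1985Variational], Sect. G pp. 306–308: the sentences
# *«Differentiation of (179) yields (182)»* and *«Differentiation of (180) yields (183) … This equation can be written as (184) … Thus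
# Eq. (184) can be solved by the Neumann series expansion (188)»* PROVED for the ACTUAL Fréchet derivatives of `B ↦ 𝒜₀(B)` and
# `B ↦ 𝓗(B)` at the level of the Sect. E–G contraction scheme (`B11Prop6Scheme.mapT`, `B11Eq174Chart.solA` / `chartH`)

statement-level skeleton of published theorems with citation tags; proofs where landed; nothing here is a claim about the Yang–Mills mass gap

PDF held: `paper:balaban1985-cmp102-variational-background` (journal page = PDF page + 276); pp. 306–308 [PDF 30–32] read by this seat from
the `lit read` text layer (2026-08-21; the displays (182)–(184), (188) are garbled there and are taken in the transcription of record of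
`B11SectG` — docstrings of `B11SectG.Eq182`, `Eq184`, `Bound188` — which this file instantiates).

CITATION HEADER (lean-in-tree rule 2026-08-18).  WHAT IS REPRODUCED: SKELETON rows (reader r08 `ROWS-B11.md`) **B11.Eq182** (so far
`typed-existing + proved-existing`, decls of record `B11SectG.Eq182`, `B11SectG.Eq184` = the equations NAMED as hypotheses on abstract
linear maps, + kernel lifts `B11KernelDictionary.eq182_lift`/`eq184_lift`) and the (188) part of **B11.Eq185** (`B11SectG.Bound188`;
`B11Eq185SecondDerivative.eq188_solution` = (188) for an abstract operator `T` of norm `< 1`).  Verbatim, p. 306 [PDF 30]: *«The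
configuration 𝓗 can be represented as 𝓗 = 𝒜₀ + H₀B − HD(𝒜₀ + H₀B), (179) where 𝒜₀ satisfies the equation obtained from (143) … Using
this new operator G we obtain the equation 𝒜₀ − GΔ⁽²⁾H₀B + G((δ/δA′)V)(𝒜₀ + H₀B) = 0. (180) It is an equation of the same type as (175),
and it has the same analyticity properties»*; p. 307 [PDF 31]: *«The functional derivative (δ/δB)𝓗(B) satisfies a linear equation obtained
by differentiations of the equations determining 𝓗(B). For example we consider Eqs. (179), (180). Differentiation of (179) yields
(δ/δB)𝓗 = (δ/δB)𝒜₀ + H₀ − H⟨𝔇(𝒜₀ + H₀B), (δ/δB)𝒜₀ + H₀⟩, (182) where the last scalar product is with respect to bonds in Ω₀ in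
η-scale. Differentiation of (180) yields (δ/δB)𝒜₀ + G̃⟨((δ²/δA′²)V)(𝒜₀ + H₀B), (δ/δB)𝒜₀ + H₀⟩ = G̃Δ⁽²⁾H₀ (183) Let us denote
𝔄₀(b, c) = (δ/δB(c))𝒜₀(B, b). We may fix a bond c ∈ 𝔅_k and consider the above equation as an equation for the function 𝔄₀(·, c).
This equation can be written as (I + G̃((δ²/δA′²)V)(𝒜₀ + H₀B))𝔄₀ = G̃Δ⁽²⁾H₀ − G̃((δ²/δA′²)V)(𝒜₀ + H₀B)H₀, (184) where the derivative
(δ²/δA′²)V is treated as a kernel of a linear operator»*; p. 308 [PDF 32]: *«for ε₁ sufficiently small, hence the norm of the linear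
operator is small also. Thus Eq. (184) can be solved by the Neumann series expansion
𝔄₀ = (I + G̃((δ²/δA′²)V)(𝒜₀ + H₀B))⁻¹(G̃Δ⁽²⁾H₀ − G̃((δ²/δA′²)V)(𝒜₀ + H₀B)H₀) (188)»*.

WHAT IS CERTIFIED (kernel, sorry-free; axioms `propext` / `Classical.choice` / `Quot.sound`).  Over complex Banach spaces `𝒳 ∋ B` (block
fields on 𝔅_k), `𝒴 ∋ X, 𝒜₀, H₀B` (the space of (115)), `𝒵` (the space G̃ acts on), with DATA `𝒢 : 𝒵 →L[ℂ] 𝒴` (G, G̃), `W : 𝒴 → 𝒵`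
(`(δ/δA′)V`), `D2 : 𝒴 →L[ℂ] 𝒵` (Δ⁽²⁾), `H₀ : 𝒳 →L[ℂ] 𝒴`, a `B11Eq174Chart.Regime 𝒢 0 W B₀ θ C₄ a₃ j a ε₄` ((117)–(121)) and
Proposition 4's analyticity letter `hWa : AnalyticOnNhd ℂ W {‖Y‖ < a₃}`, at every `B` with `‖H₀B‖ < a`, `‖Δ⁽²⁾H₀B‖ < j` (strict, so that
the parameter domain is open):
* §1 `solA180 𝒢 W D2 H₀ ε₄ B` := `solA 𝒢 0 W (−Δ⁽²⁾H₀B) ε₄ (H₀B)` (= 𝒜₀(B)) and `chartH179 … Tm ε₄ B` := `chartH …` (= 𝓗(B) =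
  Tm(𝒜₀ + H₀B)), with `mapT_180` (the map (116) at these data is `X ↦ GΔ⁽²⁾H₀B − G((δ/δA′)V)(X + H₀B)`), **`eq180`** ((180) verbatim for
  𝒜₀(B), in the ball (115)), `norm_arg180_lt` (`‖𝒜₀ + H₀B‖ < a₃`);
* §2 **`analyticAt_solA180`** / `analyticOnNhd_solA180` («the same analyticity properties»: `B ↦ 𝒜₀(B)` ANALYTIC, by
  `B11Claim309UAnalytic.analyticAt_solA` with the parameter entering through `J = −Δ⁽²⁾H₀B`, `𝔄 = H₀B`), `hasFDerivAt_solA180` (the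
  functional derivative `𝔄₀ = (δ/δB)𝒜₀` EXISTS as `fderiv ℂ (solA180 …) B`), `isOpen_dom180`;
* §3 **`eq183`** — (183) HOLDS for `𝔄₀ = fderiv ℂ (solA180 …) B` with `((δ²/δA′²)V)(𝒜₀ + H₀B) = fderiv ℂ W (𝒜₀(B) + H₀B)` (differentiate
  the identity (180), valid on the open parameter domain, by the chain rule; uniqueness of the Fréchet derivative); **`eq184`** ((184));
  `norm_comp_fderiv_lt_one` (`‖G̃((δ²/δA′²)V)(𝒜₀ + H₀B)‖ < 1` — supplied here by the contraction constant (120)–(121), i.e. the derivative of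
  the map (116) at the solution, `B11Claim309UAnalytic.norm_fderiv_mapT_lt_one`; print's own road to this smallness is (185)–(187), ε₁
  small, `B11Eq185SecondDerivative.ineq187`), `isInvertible_184`, **`eq188`** ((188) in operator form:
  `𝔄₀ = (I + G̃DW)⁻¹ ∘ (G̃Δ⁽²⁾H₀ − G̃DW H₀)`), `norm_fderiv_solA180_le` (the a-priori bound `‖𝔄₀‖ ≤ (1 − ‖T‖)⁻¹‖rhs‖` that
  `B11SectG.Bound188` names), **`eq188_apply`** (column by column, «fix a bond c»: `𝔄₀C` IS the solution `(I + T)⁻¹y` of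
  `B11Eq185SecondDerivative.eq188_solution`/`eq188_unique` and equals the Neumann series `Σₙ(−T)ⁿy`);
* §4 `hasFDerivAt_chartH179` (chain rule through a differentiable Sect. C map `Tm`), **`hasFDerivAt_chartH179_eq182`** /
  `fderiv_chartH179_eq182` — (182) HOLDS for the actual derivative of `𝓗(B) = (𝒜₀ + H₀B) − HD(𝒜₀ + H₀B)` when `D` has Fréchet derivative
  `𝔇` at `𝒜₀ + H₀B` ((64)/(70), `B11Eq63FunctionalDerivative`): `(δ/δB)𝓗 = (𝔄₀ + H₀) − H ∘ 𝔇 ∘ (𝔄₀ + H₀)`; `analyticOnNhd_chartH179`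
  («𝓗(B) is an analytic function of … B», representation (179));
* §5 **`eq184_sectG`**, **`eq182_sectG`**: the carriers `B11SectG.Eq184` / `B11SectG.Eq182` (equations named as hypotheses over ℝ-linear
  maps) are INSTANTIATED — they HOLD for the restrictions of scalars of the actual derivatives (universe-`Type` carriers, as `B11SectG`);
  v1.1 (append-only): **`bound188_sectG`** — `B11SectG.Bound188` (the a-priori boundedness of `B ↦ 𝔄₀` consumed by the (190) knit
  `B11SectG.A0_majorant_of_189` as `h188`) HOLDS for the actual derivative with `M₀ = (1 − ‖T‖)⁻¹‖rhs‖`, given two compatibility letters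
  between `B11SectG`'s block sizes and the Banach norms (local size ≤ norm on `𝒴`; norm ≤ local size at the localisation site on `𝒳`).

MODELLING.  (M1) «scalar product with respect to bonds in Ω₀» / «kernel of a linear operator» = composition of continuous linear maps
(as in `B11SectG`).  (M2) The second variational derivative `((δ²/δA′²)V)(𝒜₀ + H₀B)` IS `fderiv ℂ W (𝒜₀ + H₀B)`, `W = (δ/δA′)V`; its
Cauchy-formula description (185)–(186) is `B11Eq185SecondDerivative` (`secondDeriv_eq_fderiv`).  (M3) `G` vs `G̃ = G𝔓₀*`: one abstract
operator `𝒢` (print writes G in (180) and G̃ in (183)–(188)).  (M4) The data are those of ONE background `U_k`; the U-dependence is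
`B11Claim309UAnalytic` (§3 there).

HONEST SCOPE — what is NOT claimed.  No lattice object is constructed (G = (Δ_a − Δ⁽²⁾)⁻¹ «has exactly the same properties as Δ_a⁻¹»,
(3.137) of [5], is not typed here); the decay statements (189)–(190) and the kernel bounds (185)–(187) are untouched (`B11SectG`,
`B11Ineq189`, `B11Eq185SecondDerivative`, `B11StarDecay190`); the smallness making (188) available is taken from the regime's contraction
constant, not re-derived via (187) (same operator, recorded above).  No new named fact: two definitions with bodies (`solA180`,
`chartH179`, abbreviating tree objects at the data of (180)) and theorems over hypothesis binders.  Mega-formalization `lit-balaban`, HOME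
`run/shared/lean/pub/lit-balaban/`, reader/typer seat r08 gen 9 (unit `lit-balaban-r08`, B11 fold owner).  Imports `B11Claim309UAnalytic`
(gen 9; hence `B11Eq174Chart`, `B12LinearizAnalytic267`), `B11Eq185SecondDerivative`, `B11SectG`; modifies nothing there.
-/

namespace Literature.MathematicalPhysics.QuantumFieldTheory.Balaban1983to89.B11Eq183Differentiation

open Metric Set Filter Topology
open Literature.MathematicalPhysics.QuantumFieldTheory.Balaban1983to89
open B11Prop6Scheme B11Eq174Chart B12LinearizAnalytic267 B11Claim309UAnalytic B11Eq185SecondDerivative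

section Scheme

variable {𝒳 𝒴 𝒵 : Type*} [NormedAddCommGroup 𝒳] [NormedSpace ℂ 𝒳] [NormedAddCommGroup 𝒴] [NormedSpace ℂ 𝒴]
  [NormedAddCommGroup 𝒵] [NormedSpace ℂ 𝒵]

/-! ## §1 The objects of (179)–(180) and equation (180) in the scheme vocabulary -/

/-- **`𝒜₀(B)` of (179)–(180)**: the selected solution (`B11Eq174Chart.solA`) of the scheme equation (116) with NO linear term, source
`J = −Δ⁽²⁾H₀B` and shift `𝔄 = H₀B`, i.e. of *«𝒜₀ − GΔ⁽²⁾H₀B + G((δ/δA′)V)(𝒜₀ + H₀B) = 0 (180)»*, in the ball `‖X‖ ≤ ε₄` of (115); the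
data `𝒢` (= G = (Δ_a − Δ⁽²⁾)⁻¹ of p. 306, resp. G̃), `W` (= (δ/δA′)V), `D2` (= Δ⁽²⁾), `H₀` (the minimizer (129)) are continuous linear /
analytic DATA over abstract complex Banach spaces. [cite: Balaban1985Variational, (179)–(180) p.306] -/
noncomputable def solA180 (𝒢 : 𝒵 →L[ℂ] 𝒴) (W : 𝒴 → 𝒵) (D2 : 𝒴 →L[ℂ] 𝒵) (H₀ : 𝒳 →L[ℂ] 𝒴) (ε₄ : ℝ) (B : 𝒳) : 𝒴 :=
  solA 𝒢 0 W (-(D2 (H₀ B))) ε₄ (H₀ B)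

/-- **`𝓗(B)` in the representation (179)**, *«𝓗 = 𝒜₀ + H₀B − HD(𝒜₀ + H₀B) (179)»*: the chart `B11Eq174Chart.chartH` at the data of
(180), `𝓗(B) = Tm(𝒜₀(B) + H₀B)` with `Tm` the Sect. C map (47) `A′ ↦ A′ − HD(A′)` (a datum; specialised in `hasFDerivAt_chartH179_eq182`).
[cite: Balaban1985Variational, (179) p.306, (47) p.285] -/
noncomputable def chartH179 (𝒢 : 𝒵 →L[ℂ] 𝒴) (W : 𝒴 → 𝒵) (D2 : 𝒴 →L[ℂ] 𝒵) (H₀ : 𝒳 →L[ℂ] 𝒴) (Tm : 𝒴 → 𝒴) (ε₄ : ℝ) (B : 𝒳) : 𝒴 :=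
  chartH 𝒢 0 W (-(D2 (H₀ B))) Tm ε₄ (H₀ B)

variable {𝒢 : 𝒵 →L[ℂ] 𝒴} {W : 𝒴 → 𝒵} {D2 : 𝒴 →L[ℂ] 𝒵} {H₀ : 𝒳 →L[ℂ] 𝒴} {B₀ θ C₄ a₃ j a ε₄ : ℝ}

/-- Unfolding of `solA180`. [cite: Balaban1985Variational, (180) p.306] -/
theorem solA180_def (B : 𝒳) : solA180 𝒢 W D2 H₀ ε₄ B = solA 𝒢 0 W (-(D2 (H₀ B))) ε₄ (H₀ B) := rfl

/-- (179): `𝓗(B) = Tm(𝒜₀(B) + H₀B)`. [cite: Balaban1985Variational, (179) p.306] -/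
theorem chartH179_eq (Tm : 𝒴 → 𝒴) (B : 𝒳) :
    chartH179 𝒢 W D2 H₀ Tm ε₄ B = Tm (solA180 𝒢 W D2 H₀ ε₄ B + H₀ B) := rfl

/-- **(180) is the scheme equation with `Λ = 0`, `J = −Δ⁽²⁾H₀B`, `𝔄 = H₀B`**: the map (116) reads
`X ↦ GΔ⁽²⁾H₀B − G((δ/δA′)V)(X + H₀B)`. [cite: Balaban1985Variational, (180) p.306, (116) p.295] -/
theorem mapT_180 (B : 𝒳) (X : 𝒴) :
    mapT 𝒢 0 W (-(D2 (H₀ B))) (H₀ B) X = 𝒢 (D2 (H₀ B)) - 𝒢 (W (X + H₀ B)) := by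
  rw [mapT_noLinear, map_neg, neg_neg]

variable [CompleteSpace 𝒴]

/-- **(180)**, verbatim shape *«𝒜₀ − GΔ⁽²⁾H₀B + G((δ/δA′)V)(𝒜₀ + H₀B) = 0»* for `𝒜₀ = solA180 … B`, which lies in the ball (115),
under the regime (117)–(121) with `‖Δ⁽²⁾H₀B‖ ≤ j`, `‖H₀B‖ < a`. [cite: Balaban1985Variational, (180) p.306, Prop. 6 p.295] -/
theorem eq180 (R : Regime 𝒢 0 W B₀ θ C₄ a₃ j a ε₄) {B : 𝒳} (hJ : ‖D2 (H₀ B)‖ ≤ j) (h𝔄 : ‖H₀ B‖ < a) :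
    solA180 𝒢 W D2 H₀ ε₄ B - 𝒢 (D2 (H₀ B)) + 𝒢 (W (solA180 𝒢 W D2 H₀ ε₄ B + H₀ B)) = 0 ∧
      ‖solA180 𝒢 W D2 H₀ ε₄ B‖ ≤ ε₄ := by
  have hm := R.solA_mem (J := -(D2 (H₀ B))) (by rwa [norm_neg]) h𝔄
  refine ⟨?_, hm.1⟩
  have hfix := hm.2
  rw [mapT_180] at hfix
  rw [solA180_def]
  nth_rw 1 [← hfix]
  abel

/-- The argument `𝒜₀(B) + H₀B` of `(δ/δA′)V` in (180)/(183) lies in the analyticity ball of Proposition 4: `‖𝒜₀ + H₀B‖ < ε₄ + a < a₃`.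
[cite: Balaban1985Variational, (121) p.295, (180) p.306] -/
theorem norm_arg180_lt (R : Regime 𝒢 0 W B₀ θ C₄ a₃ j a ε₄) {B : 𝒳} (hJ : ‖D2 (H₀ B)‖ ≤ j) (h𝔄 : ‖H₀ B‖ < a) :
    ‖solA180 𝒢 W D2 H₀ ε₄ B + H₀ B‖ < a₃ := by
  have h := norm_arg_lt h𝔄 (eq180 R hJ h𝔄).2
  have hpos : 0 < ε₄ + a := (norm_nonneg _).trans_lt h
  linarith [R.dom]

/-! ## §2 `B ↦ 𝒜₀(B)` is analytic («It is an equation of the same type as (175), and it has the same analyticity properties») -/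

omit [CompleteSpace 𝒴] in
/-- The parameter domain `{B | ‖H₀B‖ < a, ‖Δ⁽²⁾H₀B‖ < j}` is open. [cite: Balaban1985Variational, (172) p.305, (180) p.306] -/
theorem isOpen_dom180 : IsOpen {B : 𝒳 | ‖H₀ B‖ < a ∧ ‖D2 (H₀ B)‖ < j} :=
  (isOpen_lt H₀.continuous.norm continuous_const).inter
    (isOpen_lt (D2.continuous.comp H₀.continuous).norm continuous_const)

variable [CompleteSpace 𝒳] [CompleteSpace 𝒵]

/-- **`B ↦ 𝒜₀(B)` IS ANALYTIC** at every `B` with `‖H₀B‖ < a`, `‖Δ⁽²⁾H₀B‖ < j` (p. 306: *«It is an equation of the same type as (175),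
and it has the same analyticity properties»*; p. 306 top: *«𝒜₁, as a solution of Eq. (175), is an analytic function of H₁B, hence of B»*):
`B11Claim309UAnalytic.analyticAt_solA` with the parameter `B` entering through `J = −Δ⁽²⁾H₀B` and `𝔄 = H₀B`, the other data constant;
the analyticity letter is Proposition 4's «(δ/δA′)V analytic on (77)» (`hWa`). [cite: Balaban1985Variational, p.306, Prop. 4 p.292] -/
theorem analyticAt_solA180 (R : Regime 𝒢 0 W B₀ θ C₄ a₃ j a ε₄) (hWa : AnalyticOnNhd ℂ W {Y : 𝒴 | ‖Y‖ < a₃})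
    {B : 𝒳} (hJ : ‖D2 (H₀ B)‖ < j) (h𝔄 : ‖H₀ B‖ < a) :
    AnalyticAt ℂ (solA180 𝒢 W D2 H₀ ε₄) B := by
  have h𝒪 : IsOpen {B' : 𝒳 | ‖H₀ B'‖ < a ∧ ‖D2 (H₀ B')‖ < j} := isOpen_dom180
  have hW2 : AnalyticOnNhd ℂ (fun p : 𝒳 × 𝒴 => W p.2)
      ({B' : 𝒳 | ‖H₀ B'‖ < a ∧ ‖D2 (H₀ B')‖ < j} ×ˢ {Y : 𝒴 | ‖Y‖ < a₃}) :=
    fun p hp => (hWa p.2 (mem_prod.mp hp).2).comp analyticAt_snd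
  have hJa : AnalyticOnNhd ℂ (fun B' : 𝒳 => -(D2 (H₀ B'))) {B' : 𝒳 | ‖H₀ B'‖ < a ∧ ‖D2 (H₀ B')‖ < j} :=
    ((D2.comp H₀).analyticOnNhd _).neg
  exact analyticAt_solA (𝒢 := fun _ : 𝒳 => 𝒢) (Λ := fun _ : 𝒳 => (0 : 𝒴 →L[ℂ] 𝒴)) (W := fun _ : 𝒳 => W)
    (J := fun B' : 𝒳 => -(D2 (H₀ B'))) (𝔄 := fun B' : 𝒳 => H₀ B') h𝒪 (fun _ _ => R)
    (fun B' hB' => by rw [norm_neg]; exact hB'.2.le) (fun B' hB' => hB'.1) analyticOnNhd_const analyticOnNhd_const hW2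
    hJa (H₀.analyticOnNhd _) ⟨h𝔄, hJ⟩

/-- `B ↦ 𝒜₀(B)` is analytic on the whole (open) parameter domain. [cite: Balaban1985Variational, p.306, Prop. 9 p.309] -/
theorem analyticOnNhd_solA180 (R : Regime 𝒢 0 W B₀ θ C₄ a₃ j a ε₄) (hWa : AnalyticOnNhd ℂ W {Y : 𝒴 | ‖Y‖ < a₃}) :
    AnalyticOnNhd ℂ (solA180 𝒢 W D2 H₀ ε₄) {B : 𝒳 | ‖H₀ B‖ < a ∧ ‖D2 (H₀ B)‖ < j} := fun _ hB =>
  analyticAt_solA180 R hWa hB.2 hB.1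

/-- `B ↦ 𝒜₀(B)` is (Fréchet-)differentiable there: the functional derivative `𝔄₀ = (δ/δB)𝒜₀` of p. 307 EXISTS as
`fderiv ℂ (solA180 …) B`. [cite: Balaban1985Variational, p.307] -/
theorem hasFDerivAt_solA180 (R : Regime 𝒢 0 W B₀ θ C₄ a₃ j a ε₄) (hWa : AnalyticOnNhd ℂ W {Y : 𝒴 | ‖Y‖ < a₃})
    {B : 𝒳} (hJ : ‖D2 (H₀ B)‖ < j) (h𝔄 : ‖H₀ B‖ < a) :
    HasFDerivAt (solA180 𝒢 W D2 H₀ ε₄) (fderiv ℂ (solA180 𝒢 W D2 H₀ ε₄) B) B :=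
  (analyticAt_solA180 R hWa hJ h𝔄).differentiableAt.hasFDerivAt

/-! ## §3 «Differentiation of (180) yields (183)»; (184); the Neumann series (188) for the actual derivative -/

/-- **(183)** (p. 307 [31], verbatim): *«Differentiation of (180) yields
(δ/δB)𝒜₀ + G̃⟨((δ²/δA′²)V)(𝒜₀ + H₀B), (δ/δB)𝒜₀ + H₀⟩ = G̃Δ⁽²⁾H₀ (183)»* — PROVED for the actual Fréchet derivative
`𝔄₀ = fderiv ℂ (solA180 …) B`, with `((δ²/δA′²)V)(𝒜₀ + H₀B) = fderiv ℂ W (𝒜₀(B) + H₀B)` («treated as a kernel of a linear operator») and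
the scalar product over bonds = composition: differentiate the identity (180), valid on the open parameter domain, by the chain rule and
use uniqueness of the derivative. [cite: Balaban1985Variational, (183) p.307] -/
theorem eq183 (R : Regime 𝒢 0 W B₀ θ C₄ a₃ j a ε₄) (hWa : AnalyticOnNhd ℂ W {Y : 𝒴 | ‖Y‖ < a₃})
    {B : 𝒳} (hJ : ‖D2 (H₀ B)‖ < j) (h𝔄 : ‖H₀ B‖ < a) :
    fderiv ℂ (solA180 𝒢 W D2 H₀ ε₄) B +
        𝒢 ∘L (fderiv ℂ W (solA180 𝒢 W D2 H₀ ε₄ B + H₀ B) ∘L (fderiv ℂ (solA180 𝒢 W D2 H₀ ε₄) B + H₀)) =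
      𝒢 ∘L (D2 ∘L H₀) := by
  set F : 𝒳 → 𝒴 := solA180 𝒢 W D2 H₀ ε₄ with hF
  set 𝔄₀ : 𝒳 →L[ℂ] 𝒴 := fderiv ℂ F B with h𝔄₀
  set Y₀ : 𝒴 := F B + H₀ B with hY₀
  have hFd : HasFDerivAt F 𝔄₀ B := hasFDerivAt_solA180 R hWa hJ h𝔄
  have hWd : HasFDerivAt W (fderiv ℂ W Y₀) Y₀ :=
    (hWa Y₀ (norm_arg180_lt R hJ.le h𝔄)).differentiableAt.hasFDerivAt
  have h1 : HasFDerivAt (fun B' : 𝒳 => F B' + H₀ B') (𝔄₀ + H₀) B := hFd.add H₀.hasFDerivAt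
  have h2 : HasFDerivAt (fun B' : 𝒳 => W (F B' + H₀ B')) (fderiv ℂ W Y₀ ∘L (𝔄₀ + H₀)) B := hWd.comp B h1
  have h3 : HasFDerivAt (fun B' : 𝒳 => 𝒢 (D2 (H₀ B'))) (𝒢 ∘L (D2 ∘L H₀)) B :=
    𝒢.hasFDerivAt.comp B (D2.hasFDerivAt.comp B H₀.hasFDerivAt)
  have h4 : HasFDerivAt (fun B' : 𝒳 => 𝒢 (W (F B' + H₀ B'))) (𝒢 ∘L (fderiv ℂ W Y₀ ∘L (𝔄₀ + H₀))) B :=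
    𝒢.hasFDerivAt.comp B h2
  have hG : HasFDerivAt (fun B' : 𝒳 => F B' - (𝒢 (D2 (H₀ B')) - 𝒢 (W (F B' + H₀ B'))))
      (𝔄₀ - (𝒢 ∘L (D2 ∘L H₀) - 𝒢 ∘L (fderiv ℂ W Y₀ ∘L (𝔄₀ + H₀)))) B := hFd.sub (h3.sub h4)
  -- the differentiated function vanishes identically near `B` (the identity (180) on the open parameter domain)
  have hev : (fun B' : 𝒳 => F B' - (𝒢 (D2 (H₀ B')) - 𝒢 (W (F B' + H₀ B')))) =ᶠ[𝓝 B] fun _ => (0 : 𝒴) := by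
    filter_upwards [isOpen_dom180.mem_nhds ⟨h𝔄, hJ⟩] with B' hB'
    have h := (eq180 R hB'.2.le hB'.1).1
    have : F B' - (𝒢 (D2 (H₀ B')) - 𝒢 (W (F B' + H₀ B'))) =
        F B' - 𝒢 (D2 (H₀ B')) + 𝒢 (W (F B' + H₀ B')) := by abel
    rw [this]; exact h
  have hzero : HasFDerivAt (fun B' : 𝒳 => F B' - (𝒢 (D2 (H₀ B')) - 𝒢 (W (F B' + H₀ B')))) (0 : 𝒳 →L[ℂ] 𝒴) B :=
    (hasFDerivAt_const (0 : 𝒴) B).congr_of_eventuallyEq hev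
  have huniq : 𝔄₀ - (𝒢 ∘L (D2 ∘L H₀) - 𝒢 ∘L (fderiv ℂ W Y₀ ∘L (𝔄₀ + H₀))) = 0 := hG.unique hzero
  rw [sub_eq_zero] at huniq
  exact eq_sub_iff_add_eq.mp huniq

/-- **(184)** (p. 307 [31], verbatim): *«This equation can be written as
(I + G̃((δ²/δA′²)V)(𝒜₀ + H₀B))𝔄₀ = G̃Δ⁽²⁾H₀ − G̃((δ²/δA′²)V)(𝒜₀ + H₀B)H₀, (184) where the derivative (δ²/δA′²)V is treated as a
kernel of a linear operator»* — for the actual derivative `𝔄₀ = fderiv ℂ (solA180 …) B` (the shape of `B11SectG.Eq184`).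
[cite: Balaban1985Variational, (184) p.307] -/
theorem eq184 (R : Regime 𝒢 0 W B₀ θ C₄ a₃ j a ε₄) (hWa : AnalyticOnNhd ℂ W {Y : 𝒴 | ‖Y‖ < a₃})
    {B : 𝒳} (hJ : ‖D2 (H₀ B)‖ < j) (h𝔄 : ‖H₀ B‖ < a) :
    fderiv ℂ (solA180 𝒢 W D2 H₀ ε₄) B +
        (𝒢 ∘L fderiv ℂ W (solA180 𝒢 W D2 H₀ ε₄ B + H₀ B)) ∘L fderiv ℂ (solA180 𝒢 W D2 H₀ ε₄) B =
      𝒢 ∘L (D2 ∘L H₀) - (𝒢 ∘L fderiv ℂ W (solA180 𝒢 W D2 H₀ ε₄ B + H₀ B)) ∘L H₀ := by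
  have h := eq183 R hWa hJ h𝔄
  rw [ContinuousLinearMap.comp_add, ContinuousLinearMap.comp_add, ← add_assoc] at h
  rw [ContinuousLinearMap.comp_assoc, ContinuousLinearMap.comp_assoc, eq_sub_iff_add_eq]
  exact h

omit [CompleteSpace 𝒳] [CompleteSpace 𝒵] in
/-- **The operator inverted in (188) has norm `< 1`**: `‖G̃((δ²/δA′²)V)(𝒜₀ + H₀B)‖ < 1`.  Print obtains this from (185)–(187) («for ε₁
sufficiently small, hence the norm of the linear operator is small also», `B11Eq185SecondDerivative.ineq187`); here it is the contraction
constant (120)–(121) of the regime — the derivative of the map (116) at the solution, `B11Claim309UAnalytic.norm_fderiv_mapT_lt_one` — the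
same operator. [cite: Balaban1985Variational, (187) p.308, (120)–(121) p.295] -/
theorem norm_comp_fderiv_lt_one (R : Regime 𝒢 0 W B₀ θ C₄ a₃ j a ε₄) (hWa : AnalyticOnNhd ℂ W {Y : 𝒴 | ‖Y‖ < a₃})
    {B : 𝒳} (hJ : ‖D2 (H₀ B)‖ ≤ j) (h𝔄 : ‖H₀ B‖ < a) :
    ‖𝒢 ∘L fderiv ℂ W (solA180 𝒢 W D2 H₀ ε₄ B + H₀ B)‖ < 1 := by
  have hX₀ := (eq180 R hJ h𝔄).2
  have hlt := norm_fderiv_mapT_lt_one (J₀ := -(D2 (H₀ B))) (𝔄₀ := H₀ B) (X₀ := solA180 𝒢 W D2 H₀ ε₄ B) R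
    hWa.differentiableOn h𝔄 hX₀
  have hd : DifferentiableAt ℂ W (solA180 𝒢 W D2 H₀ ε₄ B + H₀ B) :=
    (hWa _ (norm_arg180_lt R hJ h𝔄)).differentiableAt
  rw [(hasFDerivAt_mapT (𝒢₀ := 𝒢) (Λ₀ := (0 : 𝒴 →L[ℂ] 𝒴)) (J₀ := -(D2 (H₀ B))) hd).fderiv, zero_sub, norm_neg] at hlt
  exact hlt

omit [CompleteSpace 𝒳] [CompleteSpace 𝒵] in
/-- `I + G̃((δ²/δA′²)V)(𝒜₀ + H₀B)` is invertible, with `‖(I + ·)⁻¹‖ ≤ (1 − ‖·‖)⁻¹`. [cite: Balaban1985Variational, (188) p.308] -/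
theorem isInvertible_184 (R : Regime 𝒢 0 W B₀ θ C₄ a₃ j a ε₄) (hWa : AnalyticOnNhd ℂ W {Y : 𝒴 | ‖Y‖ < a₃})
    {B : 𝒳} (hJ : ‖D2 (H₀ B)‖ ≤ j) (h𝔄 : ‖H₀ B‖ < a) :
    (ContinuousLinearMap.id ℂ 𝒴 + 𝒢 ∘L fderiv ℂ W (solA180 𝒢 W D2 H₀ ε₄ B + H₀ B)).IsInvertible ∧
      ‖(ContinuousLinearMap.id ℂ 𝒴 + 𝒢 ∘L fderiv ℂ W (solA180 𝒢 W D2 H₀ ε₄ B + H₀ B)).inverse‖ ≤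
        (1 - ‖𝒢 ∘L fderiv ℂ W (solA180 𝒢 W D2 H₀ ε₄ B + H₀ B)‖)⁻¹ :=
  isInvertible_id_add_of_norm_le le_rfl (norm_comp_fderiv_lt_one R hWa hJ h𝔄)

/-- **(188)** (p. 308 [32], verbatim): *«Thus Eq. (184) can be solved by the Neumann series expansion
𝔄₀ = (I + G̃((δ²/δA′²)V)(𝒜₀ + H₀B))⁻¹(G̃Δ⁽²⁾H₀ − G̃((δ²/δA′²)V)(𝒜₀ + H₀B)H₀) (188)»* — operator form for the ACTUAL derivative.
[cite: Balaban1985Variational, (188) p.308] -/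
theorem eq188 (R : Regime 𝒢 0 W B₀ θ C₄ a₃ j a ε₄) (hWa : AnalyticOnNhd ℂ W {Y : 𝒴 | ‖Y‖ < a₃})
    {B : 𝒳} (hJ : ‖D2 (H₀ B)‖ < j) (h𝔄 : ‖H₀ B‖ < a) :
    fderiv ℂ (solA180 𝒢 W D2 H₀ ε₄) B =
      (ContinuousLinearMap.id ℂ 𝒴 + 𝒢 ∘L fderiv ℂ W (solA180 𝒢 W D2 H₀ ε₄ B + H₀ B)).inverse ∘L
        (𝒢 ∘L (D2 ∘L H₀) - (𝒢 ∘L fderiv ℂ W (solA180 𝒢 W D2 H₀ ε₄ B + H₀ B)) ∘L H₀) := by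
  have hinv := (isInvertible_184 R hWa hJ.le h𝔄).1
  have h184 := eq184 R hWa hJ h𝔄
  ext C
  rw [ContinuousLinearMap.comp_apply, eq_comm, hinv.inverse_apply_eq, ← h184]
  rfl

/-- **The a-priori bound behind `B11SectG.Bound188`** (the only use (190) makes of (187)–(188): the solution operator `B ↦ 𝔄₀` is
BOUNDED, with constant `(1 − ‖T‖)⁻¹ ×` the norm of the right-hand side of (184), `T = G̃((δ²/δA′²)V)(𝒜₀ + H₀B)`), in operator norm.
[cite: Balaban1985Variational, (187)–(188) p.308] -/
theorem norm_fderiv_solA180_le (R : Regime 𝒢 0 W B₀ θ C₄ a₃ j a ε₄) (hWa : AnalyticOnNhd ℂ W {Y : 𝒴 | ‖Y‖ < a₃})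
    {B : 𝒳} (hJ : ‖D2 (H₀ B)‖ < j) (h𝔄 : ‖H₀ B‖ < a) :
    ‖fderiv ℂ (solA180 𝒢 W D2 H₀ ε₄) B‖ ≤
      (1 - ‖𝒢 ∘L fderiv ℂ W (solA180 𝒢 W D2 H₀ ε₄ B + H₀ B)‖)⁻¹ *
        ‖𝒢 ∘L (D2 ∘L H₀) - (𝒢 ∘L fderiv ℂ W (solA180 𝒢 W D2 H₀ ε₄ B + H₀ B)) ∘L H₀‖ := by
  rw [eq188 R hWa hJ h𝔄]
  refine (ContinuousLinearMap.opNorm_comp_le _ _).trans ?_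
  gcongr
  exact (isInvertible_184 R hWa hJ.le h𝔄).2

/-- **(188) column by column, as print solves it** (*«We may fix a bond c ∈ 𝔅_k and consider the above equation as an equation for the
function 𝔄₀(·, c)»*, p. 307): for every direction `C` (the unit configuration at the bond `c`), the column `𝔄₀C` is THE solution
`(I + T)⁻¹y` of `B11Eq185SecondDerivative` ((188) there: `eq188_solution` / `eq188_unique`) with `T = G̃((δ²/δA′²)V)(𝒜₀ + H₀B)`,
`y = G̃Δ⁽²⁾H₀C − T H₀C`, and equals the Neumann series `Σₙ (−T)ⁿ y`. [cite: Balaban1985Variational, (188) p.308, p.307] -/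
theorem eq188_apply (R : Regime 𝒢 0 W B₀ θ C₄ a₃ j a ε₄) (hWa : AnalyticOnNhd ℂ W {Y : 𝒴 | ‖Y‖ < a₃})
    {B : 𝒳} (hJ : ‖D2 (H₀ B)‖ < j) (h𝔄 : ‖H₀ B‖ < a) (C : 𝒳) :
    fderiv ℂ (solA180 𝒢 W D2 H₀ ε₄) B C =
        ((onePlusUnit (𝒢 ∘L fderiv ℂ W (solA180 𝒢 W D2 H₀ ε₄ B + H₀ B))
            (norm_comp_fderiv_lt_one R hWa hJ.le h𝔄))⁻¹ : (𝒴 →L[ℂ] 𝒴)ˣ).val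
          (𝒢 (D2 (H₀ C)) - 𝒢 (fderiv ℂ W (solA180 𝒢 W D2 H₀ ε₄ B + H₀ B) (H₀ C))) ∧
      fderiv ℂ (solA180 𝒢 W D2 H₀ ε₄) B C =
        (∑' n : ℕ, (-(𝒢 ∘L fderiv ℂ W (solA180 𝒢 W D2 H₀ ε₄ B + H₀ B))) ^ n)
          (𝒢 (D2 (H₀ C)) - 𝒢 (fderiv ℂ W (solA180 𝒢 W D2 H₀ ε₄ B + H₀ B) (H₀ C))) := by
  set T : 𝒴 →L[ℂ] 𝒴 := 𝒢 ∘L fderiv ℂ W (solA180 𝒢 W D2 H₀ ε₄ B + H₀ B) with hT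
  have hTn : ‖T‖ < 1 := norm_comp_fderiv_lt_one R hWa hJ.le h𝔄
  have h₁ : fderiv ℂ (solA180 𝒢 W D2 H₀ ε₄) B C + T (fderiv ℂ (solA180 𝒢 W D2 H₀ ε₄) B C) =
      𝒢 (D2 (H₀ C)) - 𝒢 (fderiv ℂ W (solA180 𝒢 W D2 H₀ ε₄ B + H₀ B) (H₀ C)) := by
    have h := congrArg (fun f : 𝒳 →L[ℂ] 𝒴 => f C) (eq184 R hWa hJ h𝔄)
    simpa [hT] using h
  have hsol := eq188_unique T hTn h₁ (eq188_solution T hTn _)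
  exact ⟨hsol, by rw [hsol, eq188_neumann_series]⟩

/-! ## §4 «Differentiation of (179) yields (182)» -/

/-- **The derivative of the chart through a differentiable Sect. C map**: if `Tm` has Fréchet derivative `Tm'` at `𝒜₀(B) + H₀B`, then
`B ↦ 𝓗(B) = Tm(𝒜₀(B) + H₀B)` has derivative `Tm' ∘ (𝔄₀ + H₀)` at `B` (chain rule on (179)). [cite: Balaban1985Variational, (182) p.307] -/
theorem hasFDerivAt_chartH179 (R : Regime 𝒢 0 W B₀ θ C₄ a₃ j a ε₄) (hWa : AnalyticOnNhd ℂ W {Y : 𝒴 | ‖Y‖ < a₃})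
    {B : 𝒳} (hJ : ‖D2 (H₀ B)‖ < j) (h𝔄 : ‖H₀ B‖ < a) {Tm : 𝒴 → 𝒴} {Tm' : 𝒴 →L[ℂ] 𝒴}
    (hTm : HasFDerivAt Tm Tm' (solA180 𝒢 W D2 H₀ ε₄ B + H₀ B)) :
    HasFDerivAt (chartH179 𝒢 W D2 H₀ Tm ε₄) (Tm' ∘L (fderiv ℂ (solA180 𝒢 W D2 H₀ ε₄) B + H₀)) B := by
  have h1 : HasFDerivAt (fun B' : 𝒳 => solA180 𝒢 W D2 H₀ ε₄ B' + H₀ B') (fderiv ℂ (solA180 𝒢 W D2 H₀ ε₄) B + H₀) B :=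
    (hasFDerivAt_solA180 R hWa hJ h𝔄).add H₀.hasFDerivAt
  exact hTm.comp B h1

/-- **(182)** (p. 307 [31], verbatim): *«Differentiation of (179) yields
(δ/δB)𝓗 = (δ/δB)𝒜₀ + H₀ − H⟨𝔇(𝒜₀ + H₀B), (δ/δB)𝒜₀ + H₀⟩, (182) where the last scalar product is with respect to bonds in Ω₀ in
η-scale»* — PROVED for the actual derivatives: with the Sect. C map `Tm Y = Y − H(D(Y))` ((47)), `D` having Fréchet derivative
`𝔇 = 𝔇(𝒜₀ + H₀B)` ((64), (70)) at `𝒜₀(B) + H₀B` and `H` the operator (45), the derivative of `𝓗` at `B` is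
`(𝔄₀ + H₀) − H ∘ 𝔇 ∘ (𝔄₀ + H₀)` (the shape of `B11SectG.Eq182`). [cite: Balaban1985Variational, (182) p.307, (47) p.285, (64) p.288] -/
theorem hasFDerivAt_chartH179_eq182 {𝒲 : Type*} [NormedAddCommGroup 𝒲] [NormedSpace ℂ 𝒲]
    (R : Regime 𝒢 0 W B₀ θ C₄ a₃ j a ε₄) (hWa : AnalyticOnNhd ℂ W {Y : 𝒴 | ‖Y‖ < a₃})
    {B : 𝒳} (hJ : ‖D2 (H₀ B)‖ < j) (h𝔄 : ‖H₀ B‖ < a) {D : 𝒴 → 𝒲} {𝔇 : 𝒴 →L[ℂ] 𝒲} (H : 𝒲 →L[ℂ] 𝒴)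
    (hD : HasFDerivAt D 𝔇 (solA180 𝒢 W D2 H₀ ε₄ B + H₀ B)) :
    HasFDerivAt (chartH179 𝒢 W D2 H₀ (fun Y : 𝒴 => Y - H (D Y)) ε₄)
      ((fderiv ℂ (solA180 𝒢 W D2 H₀ ε₄) B + H₀) - H ∘L (𝔇 ∘L (fderiv ℂ (solA180 𝒢 W D2 H₀ ε₄) B + H₀))) B := by
  have hTm : HasFDerivAt (fun Y : 𝒴 => Y - H (D Y)) (ContinuousLinearMap.id ℂ 𝒴 - H ∘L 𝔇)
      (solA180 𝒢 W D2 H₀ ε₄ B + H₀ B) := (hasFDerivAt_id _).sub (H.hasFDerivAt.comp _ hD)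
  have h := hasFDerivAt_chartH179 R hWa hJ h𝔄 hTm
  rwa [ContinuousLinearMap.sub_comp, ContinuousLinearMap.id_comp, ContinuousLinearMap.comp_assoc] at h

/-- (182) for `fderiv`. [cite: Balaban1985Variational, (182) p.307] -/
theorem fderiv_chartH179_eq182 {𝒲 : Type*} [NormedAddCommGroup 𝒲] [NormedSpace ℂ 𝒲]
    (R : Regime 𝒢 0 W B₀ θ C₄ a₃ j a ε₄) (hWa : AnalyticOnNhd ℂ W {Y : 𝒴 | ‖Y‖ < a₃})
    {B : 𝒳} (hJ : ‖D2 (H₀ B)‖ < j) (h𝔄 : ‖H₀ B‖ < a) {D : 𝒴 → 𝒲} {𝔇 : 𝒴 →L[ℂ] 𝒲} (H : 𝒲 →L[ℂ] 𝒴)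
    (hD : HasFDerivAt D 𝔇 (solA180 𝒢 W D2 H₀ ε₄ B + H₀ B)) :
    fderiv ℂ (chartH179 𝒢 W D2 H₀ (fun Y : 𝒴 => Y - H (D Y)) ε₄) B =
      (fderiv ℂ (solA180 𝒢 W D2 H₀ ε₄) B + H₀) - H ∘L (𝔇 ∘L (fderiv ℂ (solA180 𝒢 W D2 H₀ ε₄) B + H₀)) :=
  (hasFDerivAt_chartH179_eq182 R hWa hJ h𝔄 H hD).fderiv

/-- **`𝓗` is analytic in `B`** in the representation (179)–(180) (p. 306: *«Independently of the representation chosen, the function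
𝓗(B) is an analytic function of 𝔤ᶜ-valued configurations B … satisfying (172)»*), for a Sect. C map analytic on the ball
`‖Y‖ < ε₄ + a` containing the arguments. [cite: Balaban1985Variational, p.306–307, Prop. 9 p.309] -/
theorem analyticOnNhd_chartH179 (R : Regime 𝒢 0 W B₀ θ C₄ a₃ j a ε₄) (hWa : AnalyticOnNhd ℂ W {Y : 𝒴 | ‖Y‖ < a₃})
    {Tm : 𝒴 → 𝒴} (hTm : AnalyticOnNhd ℂ Tm {Y : 𝒴 | ‖Y‖ < ε₄ + a}) :
    AnalyticOnNhd ℂ (chartH179 𝒢 W D2 H₀ Tm ε₄) {B : 𝒳 | ‖H₀ B‖ < a ∧ ‖D2 (H₀ B)‖ < j} := by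
  intro B hB
  have harg : AnalyticAt ℂ (fun B' : 𝒳 => solA180 𝒢 W D2 H₀ ε₄ B' + H₀ B') B :=
    (analyticAt_solA180 R hWa hB.2 hB.1).add (H₀.analyticAt B)
  have hmem : ‖solA180 𝒢 W D2 H₀ ε₄ B + H₀ B‖ < ε₄ + a := norm_arg_lt hB.1 (eq180 R hB.2.le hB.1).2
  have h := AnalyticAt.comp_of_eq (hTm _ hmem) harg rfl
  exact h

end Scheme

/-! ## §5 The carriers `B11SectG.Eq182` / `B11SectG.Eq184` are INSTANTIATED by the actual derivatives -/

section SectGBridge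

variable {𝒳 𝒴 𝒵 : Type} [NormedAddCommGroup 𝒳] [NormedSpace ℂ 𝒳] [NormedAddCommGroup 𝒴] [NormedSpace ℂ 𝒴]
  [NormedAddCommGroup 𝒵] [NormedSpace ℂ 𝒵] [CompleteSpace 𝒳] [CompleteSpace 𝒴] [CompleteSpace 𝒵]
  {𝒢 : 𝒵 →L[ℂ] 𝒴} {W : 𝒴 → 𝒵} {D2 : 𝒴 →L[ℂ] 𝒵} {H₀ : 𝒳 →L[ℂ] 𝒴} {B₀ θ C₄ a₃ j a ε₄ : ℝ}

/-- `B11SectG.Eq184` HOLDS for `A0 := (δ/δB)𝒜₀ = fderiv ℂ (solA180 …) B`, `Gt := G̃`, `W := ((δ²/δA′²)V)(𝒜₀ + H₀B) = fderiv ℂ W (𝒜₀ + H₀B)`,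
`D2H0 := Δ⁽²⁾H₀` (all as ℝ-linear maps, the bookkeeping of `B11SectG` being over ℝ). [cite: Balaban1985Variational, (184) p.307] -/
theorem eq184_sectG (R : Regime 𝒢 0 W B₀ θ C₄ a₃ j a ε₄) (hWa : AnalyticOnNhd ℂ W {Y : 𝒴 | ‖Y‖ < a₃})
    {B : 𝒳} (hJ : ‖D2 (H₀ B)‖ < j) (h𝔄 : ‖H₀ B‖ < a) :
    B11SectG.Eq184 ((fderiv ℂ (solA180 𝒢 W D2 H₀ ε₄) B).restrictScalars ℝ : 𝒳 →ₗ[ℝ] 𝒴) (H₀.restrictScalars ℝ : 𝒳 →ₗ[ℝ] 𝒴)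
      (𝒢.restrictScalars ℝ : 𝒵 →ₗ[ℝ] 𝒴) ((fderiv ℂ W (solA180 𝒢 W D2 H₀ ε₄ B + H₀ B)).restrictScalars ℝ : 𝒴 →ₗ[ℝ] 𝒵)
      ((D2 ∘L H₀).restrictScalars ℝ : 𝒳 →ₗ[ℝ] 𝒵) := by
  have h := eq184 R hWa hJ h𝔄
  unfold B11SectG.Eq184
  ext C
  have hC := congrArg (fun f : 𝒳 →L[ℂ] 𝒴 => f C) h
  simpa using hC

/-- `B11SectG.Eq182` HOLDS for `dH := (δ/δB)𝓗 = fderiv ℂ (chartH179 … (· − H(D ·)) …) B`, `A0 := (δ/δB)𝒜₀`, `H0 := H₀`, `H := H`,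
`Dfr := 𝔇(𝒜₀ + H₀B)`. [cite: Balaban1985Variational, (182) p.307] -/
theorem eq182_sectG (R : Regime 𝒢 0 W B₀ θ C₄ a₃ j a ε₄) (hWa : AnalyticOnNhd ℂ W {Y : 𝒴 | ‖Y‖ < a₃})
    {B : 𝒳} (hJ : ‖D2 (H₀ B)‖ < j) (h𝔄 : ‖H₀ B‖ < a) {D : 𝒴 → 𝒳} {𝔇 : 𝒴 →L[ℂ] 𝒳} (H : 𝒳 →L[ℂ] 𝒴)
    (hD : HasFDerivAt D 𝔇 (solA180 𝒢 W D2 H₀ ε₄ B + H₀ B)) :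
    B11SectG.Eq182 ((fderiv ℂ (chartH179 𝒢 W D2 H₀ (fun Y : 𝒴 => Y - H (D Y)) ε₄) B).restrictScalars ℝ : 𝒳 →ₗ[ℝ] 𝒴)
      ((fderiv ℂ (solA180 𝒢 W D2 H₀ ε₄) B).restrictScalars ℝ : 𝒳 →ₗ[ℝ] 𝒴) (H₀.restrictScalars ℝ : 𝒳 →ₗ[ℝ] 𝒴)
      (H.restrictScalars ℝ : 𝒳 →ₗ[ℝ] 𝒴) (𝔇.restrictScalars ℝ : 𝒴 →ₗ[ℝ] 𝒳) := by
  have h := fderiv_chartH179_eq182 R hWa hJ h𝔄 H hD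
  unfold B11SectG.Eq182
  ext C
  have hC := congrArg (fun f : 𝒳 →L[ℂ] 𝒴 => f C) h
  simpa using hC


/-! ### v1.1 (gen 9, append-only): `B11SectG.Bound188` from the operator norm -/

/-- **`B11SectG.Bound188` HOLDS for the actual derivative** `A0 := (δ/δB)𝒜₀ = fderiv ℂ (solA180 …) B` with the constant
`M₀ = (1 − ‖T‖)⁻¹ · ‖G̃Δ⁽²⁾H₀ − T H₀‖` of `norm_fderiv_solA180_le` (`T = G̃((δ²/δA′²)V)(𝒜₀ + H₀B)`) — the TYPED CONSEQUENCE of (187)–(188)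
that the (190) knit `B11SectG.A0_majorant_of_189` consumes as `h188` — given the two compatibility letters between the block sizes of
`B11SectG` and the Banach norms: on `FA = 𝒴` the local size is dominated by the norm (`hN`), on `FB = 𝒳` the norm of a field localised
at `y′` is dominated by its local size there (`hB`). [cite: Balaban1985Variational, (187)–(188) p.308] -/
theorem bound188_sectG {g : B6.Geometry} (R : Regime 𝒢 0 W B₀ θ C₄ a₃ j a ε₄) (hWa : AnalyticOnNhd ℂ W {Y : 𝒴 | ‖Y‖ < a₃})
    {B : 𝒳} (hJ : ‖D2 (H₀ B)‖ < j) (h𝔄 : ‖H₀ B‖ < a) {bB : B11SectG.BlockNorm g 𝒳} {bN : B11SectG.BlockNorm g 𝒴}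
    (hN : ∀ (y : g.Site) (v : 𝒴), bN.loc y v ≤ ‖v‖) (hB : ∀ (y' : g.Site) (μ : 𝒳), bB.IsLoc y' μ → ‖μ‖ ≤ bB.loc y' μ) :
    B11SectG.Bound188 bB bN ((fderiv ℂ (solA180 𝒢 W D2 H₀ ε₄) B).restrictScalars ℝ : 𝒳 →ₗ[ℝ] 𝒴)
      ((1 - ‖𝒢 ∘L fderiv ℂ W (solA180 𝒢 W D2 H₀ ε₄ B + H₀ B)‖)⁻¹ *
        ‖𝒢 ∘L (D2 ∘L H₀) - (𝒢 ∘L fderiv ℂ W (solA180 𝒢 W D2 H₀ ε₄ B + H₀ B)) ∘L H₀‖) := by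
  set M : ℝ := (1 - ‖𝒢 ∘L fderiv ℂ W (solA180 𝒢 W D2 H₀ ε₄ B + H₀ B)‖)⁻¹ *
    ‖𝒢 ∘L (D2 ∘L H₀) - (𝒢 ∘L fderiv ℂ W (solA180 𝒢 W D2 H₀ ε₄ B + H₀ B)) ∘L H₀‖ with hM
  have hM0 : 0 ≤ M :=
    mul_nonneg (inv_nonneg.mpr (sub_nonneg.mpr (norm_comp_fderiv_lt_one R hWa hJ.le h𝔄).le)) (norm_nonneg _)
  have hop : ‖fderiv ℂ (solA180 𝒢 W D2 H₀ ε₄) B‖ ≤ M := norm_fderiv_solA180_le R hWa hJ h𝔄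
  intro y' μ hμ y
  have happ : ((fderiv ℂ (solA180 𝒢 W D2 H₀ ε₄) B).restrictScalars ℝ : 𝒳 →ₗ[ℝ] 𝒴) μ =
      fderiv ℂ (solA180 𝒢 W D2 H₀ ε₄) B μ := rfl
  rw [happ]
  calc bN.loc y (fderiv ℂ (solA180 𝒢 W D2 H₀ ε₄) B μ) ≤ ‖fderiv ℂ (solA180 𝒢 W D2 H₀ ε₄) B μ‖ := hN y _
    _ ≤ ‖fderiv ℂ (solA180 𝒢 W D2 H₀ ε₄) B‖ * ‖μ‖ := ContinuousLinearMap.le_opNorm _ _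
    _ ≤ M * ‖μ‖ := mul_le_mul_of_nonneg_right hop (norm_nonneg _)
    _ ≤ M * bB.loc y' μ := mul_le_mul_of_nonneg_left (hB y' μ hμ) hM0

end SectGBridge

end Literature.MathematicalPhysics.QuantumFieldTheory.Balaban1983to89.B11Eq183Differentiation
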